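import Mathlib.Geometry.Euclidean.Volume.Measure
import Mathlib.MeasureTheory.Measure.Lebesgue.VolumeOfBalls
import Mathlib.Analysis.InnerProductSpace.Projection.FiniteDimensional
import Mathlib.Analysis.SpecialFunctions.Integrals.Basic
import HarnessLib

/-!
# The volume of a right circular cone cut off by the unit ball (solid angle of a spherical cap)

Topic `Literature/Geometry/DiscreteGeometry` (sibling of `SphericalWedgeVolume.lean`,
`SolidAngleFraction.lean`): for a unit vector `a` of `ℝ³` and `0 < c < 1`, the open cone
`{x | c‖x‖ < ⟪a, x⟫}` (half-angle `arccos c` about `a`) meets the unit ball in a set of volume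
`(2π/3)(1 − c)` — Archimedes' measurement of the spherical sector, equivalently the solid angle
`2π(1 − cos r)` of a spherical cap of angular radius `r`, i.e. the unit-ball fraction
`(1 − cos r)/2`.  Proof by slicing orthogonally to the axis
(`EuclideanGeometry.euclideanHausdorffMeasure_eq_lintegral`): the slice at height `h ∈ (0, 1)`
is a flat disc of squared radius `min 1 (h²/c²) − h²`, of area `π` times that, and
`∫₀¹ (min 1 (h²/c²) − h²) dh = 2(1 − c)/3`.
-/

noncomputable section

namespace Literature.Geometry.DiscreteGeometry

open Real RealInnerProductSpace MeasureTheory Measure Metric Set Module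

/-! ### Part 1. Flat discs have area `π ρ²` -/

section Disc

/-- The plane through `h • a` orthogonal to the unit vector `a` is `{y | ⟪a, y⟫ = h}`. [folklore] -/
theorem mem_mk'_orthogonal_iff {a : EuclideanSpace ℝ (Fin 3)} (ha : ‖a‖ = 1) (h : ℝ)
    (y : EuclideanSpace ℝ (Fin 3)) :
    y ∈ AffineSubspace.mk' (h • a) (ℝ ∙ a)ᗮ ↔ ⟪a, y⟫ = h := by
  rw [AffineSubspace.mem_mk', Submodule.mem_orthogonal_singleton_iff_inner_right, vsub_eq_sub,
    inner_sub_right, real_inner_smul_right, real_inner_self_eq_norm_sq, ha]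
  constructor <;> intro H <;> linarith

/-- The orthogonal complement of a unit vector of `ℝ³` is two-dimensional. [folklore] -/
theorem finrank_orthogonal_unit {a : EuclideanSpace ℝ (Fin 3)} (ha : ‖a‖ = 1) :
    finrank ℝ (ℝ ∙ a)ᗮ = 2 := by
  haveI : Fact (finrank ℝ (EuclideanSpace ℝ (Fin 3)) = 2 + 1) := ⟨by simp⟩
  have ha0 : a ≠ 0 := by
    intro h0; rw [h0, norm_zero] at ha; exact zero_ne_one ha
  exact Submodule.finrank_orthogonal_span_singleton ha0

/-- **A flat disc in `ℝ³` has two-dimensional (Euclidean-normalised Hausdorff) measure `π ρ²`.**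
For a unit vector `a`, a height `h` and a radius `ρ`, the disc
`{y | ⟪a, y⟫ = h ∧ dist y (h • a) < ρ}` — the image of the ball of radius `ρ` of the plane `a^⊥`
under the isometric embedding `w ↦ w + h • a` — has `μHE[2]`-measure `π ρ²`. [folklore] -/
theorem euclideanHausdorffMeasure_two_disc {a : EuclideanSpace ℝ (Fin 3)} (ha : ‖a‖ = 1)
    (h ρ : ℝ) :
    μHE[2] ({y : EuclideanSpace ℝ (Fin 3) | ⟪a, y⟫ = h} ∩ ball (h • a) ρ) =
      ENNReal.ofReal ρ ^ 2 * ENNReal.ofReal π := by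
  set W : Submodule ℝ (EuclideanSpace ℝ (Fin 3)) := (ℝ ∙ a)ᗮ with hW
  -- the isometric embedding of the plane `W` at height `h`
  let ι : W → EuclideanSpace ℝ (Fin 3) := fun w => (w : EuclideanSpace ℝ (Fin 3)) + h • a
  have hι : Isometry ι := by
    intro w w'
    simp only [ι]
    rw [edist_add_right]
    rfl
  have himage : ι '' (ball (0 : W) ρ) = {y | ⟪a, y⟫ = h} ∩ ball (h • a) ρ := by
    ext y
    simp only [mem_image, mem_ball, mem_inter_iff, mem_setOf_eq, dist_zero_right, ι]
    constructor
    · rintro ⟨w, hw, rfl⟩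
      have hwa : ⟪a, (w : EuclideanSpace ℝ (Fin 3))⟫ = 0 :=
        (Submodule.mem_orthogonal_singleton_iff_inner_right).1 w.2
      refine ⟨?_, ?_⟩
      · rw [inner_add_right, hwa, real_inner_smul_right, real_inner_self_eq_norm_sq, ha]; ring
      · rwa [dist_eq_norm, add_sub_cancel_right, ← Submodule.coe_norm]
    · rintro ⟨hy, hd⟩
      have hmem : y - h • a ∈ W := by
        rw [hW, Submodule.mem_orthogonal_singleton_iff_inner_right, inner_sub_right, hy,
          real_inner_smul_right, real_inner_self_eq_norm_sq, ha]; ring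
      refine ⟨⟨y - h • a, hmem⟩, ?_, ?_⟩
      · rw [Submodule.coe_norm, Submodule.coe_mk, ← dist_eq_norm]; exact hd
      · simp
  rw [← himage, hι.euclideanHausdorffMeasure_image]
  have hfr : finrank ℝ W = 2 := finrank_orthogonal_unit ha
  haveI : Nontrivial W := Module.nontrivial_of_finrank_pos (R := ℝ) (by rw [hfr]; norm_num)
  have hvol : (μHE[2] : Measure W) = volume := by
    have := InnerProductSpace.euclideanHausdorffMeasure_eq_volume (V := W)
    rwa [hfr] at this
  rw [hvol, InnerProductSpace.volume_ball_of_dim_even (k := 1) (by rw [hfr]), hfr]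
  simp

end Disc

/-! ### Part 2. The cone, its slices, and the slicing integral -/

section Cone

/-- The squared radius of the slice of the cone `{c‖x‖ < ⟪a, x⟫} ∩ B(0,1)` at height `t`:
`min 1 (t²/c²) − t²` clipped to `[0, ∞)`, and `0` at nonpositive heights. [folklore] -/
def sliceSq (c t : ℝ) : ℝ := if 0 < t then max 0 (min 1 (t ^ 2 / c ^ 2) - t ^ 2) else 0

/-- `sliceSq` is nonnegative. [folklore] -/
theorem sliceSq_nonneg (c t : ℝ) : 0 ≤ sliceSq c t := by
  unfold sliceSq; split_ifs
  · exact le_max_left _ _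
  · exact le_rfl

/-- On `(0, c]` (`0 < c ≤ 1`) the squared slice radius is `t² (1 − c²)/c²`. [folklore] -/
theorem sliceSq_of_le {c t : ℝ} (hc : 0 < c) (hc1 : c ≤ 1) (ht : 0 < t) (htc : t ≤ c) :
    sliceSq c t = (1 - c ^ 2) / c ^ 2 * t ^ 2 := by
  unfold sliceSq
  rw [if_pos ht]
  have hc2 : 0 < c ^ 2 := by positivity
  have h1 : t ^ 2 / c ^ 2 ≤ 1 := by
    rw [div_le_one hc2]; exact pow_le_pow_left₀ ht.le htc 2
  rw [min_eq_right h1, max_eq_right]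
  · field_simp
  · rw [div_sub' (ne_of_gt hc2), le_div_iff₀ hc2, zero_mul]
    nlinarith [sq_nonneg t, mul_le_mul_of_nonneg_left (pow_le_one₀ hc.le hc1 : c ^ 2 ≤ 1)
      (sq_nonneg t)]

/-- On `[c, 1]` (`0 < c`) the squared slice radius is `1 − t²`. [folklore] -/
theorem sliceSq_of_ge {c t : ℝ} (hc : 0 < c) (hct : c ≤ t) (ht1 : t ≤ 1) :
    sliceSq c t = 1 - t ^ 2 := by
  unfold sliceSq
  have ht : 0 < t := hc.trans_le hct
  rw [if_pos ht]
  have hc2 : 0 < c ^ 2 := by positivity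
  have h1 : 1 ≤ t ^ 2 / c ^ 2 := by
    rw [one_le_div hc2]; exact pow_le_pow_left₀ hc.le hct 2
  rw [min_eq_left h1, max_eq_right]
  nlinarith

/-- Above height `1` the slice is empty (`sliceSq = 0`). [folklore] -/
theorem sliceSq_of_one_le {c t : ℝ} (hc : 0 < c) (hc1 : c ≤ 1) (ht : 1 ≤ t) :
    sliceSq c t = 0 := by
  unfold sliceSq
  rw [if_pos (by linarith)]
  have hc2 : 0 < c ^ 2 := by positivity
  have h1 : 1 ≤ t ^ 2 / c ^ 2 := by
    rw [one_le_div hc2]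
    calc c ^ 2 ≤ 1 := pow_le_one₀ hc.le hc1
      _ ≤ t ^ 2 := by nlinarith
  rw [min_eq_left h1, max_eq_left]
  nlinarith

/-- At nonpositive heights the slice is empty. [folklore] -/
theorem sliceSq_of_nonpos {c t : ℝ} (ht : t ≤ 0) : sliceSq c t = 0 := by
  unfold sliceSq; rw [if_neg (not_lt.2 ht)]

/-- `sliceSq c` is bounded by `1` for `0 < c ≤ 1`. [folklore] -/
theorem sliceSq_le_one {c : ℝ} (hc : 0 < c) (hc1 : c ≤ 1) (t : ℝ) : sliceSq c t ≤ 1 := by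
  rcases le_or_gt t 0 with ht | ht
  · rw [sliceSq_of_nonpos ht]; exact zero_le_one
  rcases le_or_gt t c with htc | htc
  · rw [sliceSq_of_le hc hc1 ht htc]
    have : t ^ 2 ≤ c ^ 2 := pow_le_pow_left₀ ht.le htc 2
    have hc2 : 0 < c ^ 2 := by positivity
    rw [div_mul_eq_mul_div, div_le_one hc2]
    nlinarith [sq_nonneg t, sq_nonneg c]
  rcases le_or_gt t 1 with ht1 | ht1
  · rw [sliceSq_of_ge hc htc.le ht1]; nlinarith
  · rw [sliceSq_of_one_le hc hc1 ht1.le]; exact zero_le_one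

/-- **The open cone of half-angle `arccos c` about `a`, cut off by the unit ball.** [folklore] -/
def capCone (a : EuclideanSpace ℝ (Fin 3)) (c : ℝ) : Set (EuclideanSpace ℝ (Fin 3)) :=
  {x | c * ‖x‖ < ⟪a, x⟫} ∩ ball 0 1

/-- The cut-off cone is an open, hence measurable, set. [folklore] -/
theorem measurableSet_capCone (a : EuclideanSpace ℝ (Fin 3)) (c : ℝ) :
    MeasurableSet (capCone a c) := by
  refine MeasurableSet.inter ?_ measurableSet_ball
  exact (isOpen_lt (by fun_prop) (by fun_prop)).measurableSet

/-- **The slices of the cone are discs.** For a unit vector `a` and `0 < c`, the slice of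
`capCone a c` by the plane `⟪a, ·⟫ = t` is the flat disc about `t • a` of squared radius
`sliceSq c t` (Pythagoras: `‖y‖² = dist (y, t•a)² + t²` on that plane). [folklore] -/
theorem capCone_inter_plane {a : EuclideanSpace ℝ (Fin 3)} (ha : ‖a‖ = 1) {c : ℝ} (hc : 0 < c)
    (t : ℝ) :
    capCone a c ∩ (AffineSubspace.mk' (t • a) (ℝ ∙ a)ᗮ : Set (EuclideanSpace ℝ (Fin 3))) =
      {y | ⟪a, y⟫ = t} ∩ ball (t • a) (Real.sqrt (sliceSq c t)) := by
  ext y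
  simp only [capCone, mem_inter_iff, mem_setOf_eq, mem_ball, dist_zero_right, SetLike.mem_coe,
    mem_mk'_orthogonal_iff ha]
  have haa : ⟪a, a⟫ = 1 := by rw [real_inner_self_eq_norm_sq, ha]; norm_num
  -- Pythagoras on the plane `⟪a, y⟫ = t`
  have pyth : ⟪a, y⟫ = t → ‖y‖ ^ 2 = dist y (t • a) ^ 2 + t ^ 2 := fun hy => by
    rw [dist_eq_norm, ← real_inner_self_eq_norm_sq (y - t • a), ← real_inner_self_eq_norm_sq y,
      inner_sub_left, inner_sub_right, inner_sub_right, real_inner_smul_left,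
      real_inner_smul_right, real_inner_smul_left, real_inner_smul_right, real_inner_comm a y, hy,
      haa]
    ring
  constructor
  · rintro ⟨⟨hcone, hball⟩, hy⟩
    refine ⟨hy, ?_⟩
    have ht : 0 < t := by
      rw [hy] at hcone
      exact lt_of_le_of_lt (mul_nonneg hc.le (norm_nonneg _)) hcone
    have hd0 : 0 ≤ dist y (t • a) := dist_nonneg
    have hy2 := pyth hy
    -- `dist² < sliceSq`
    have hlt : dist y (t • a) ^ 2 < sliceSq c t := by
      unfold sliceSq
      rw [if_pos ht, lt_max_iff]
      right
      rw [lt_sub_iff_add_lt, ← hy2, lt_min_iff]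
      constructor
      · nlinarith [norm_nonneg y]
      · rw [lt_div_iff₀ (by positivity : (0 : ℝ) < c ^ 2)]
        rw [hy] at hcone
        have h1 : 0 ≤ c * ‖y‖ := mul_nonneg hc.le (norm_nonneg _)
        nlinarith
    calc dist y (t • a) = Real.sqrt (dist y (t • a) ^ 2) := (Real.sqrt_sq hd0).symm
      _ < Real.sqrt (sliceSq c t) := Real.sqrt_lt_sqrt (sq_nonneg _) hlt
  · rintro ⟨hy, hd⟩
    have hpos : 0 < sliceSq c t := by
      by_contra hle
      push Not at hle
      have : Real.sqrt (sliceSq c t) = 0 := Real.sqrt_eq_zero'.2 hle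
      rw [this] at hd
      exact (not_lt.2 dist_nonneg) hd
    have ht : 0 < t := by
      by_contra hle
      push Not at hle
      rw [sliceSq_of_nonpos hle] at hpos
      exact lt_irrefl _ hpos
    have hd2 : dist y (t • a) ^ 2 < sliceSq c t := by
      have := pow_lt_pow_left₀ hd dist_nonneg two_ne_zero
      rwa [Real.sq_sqrt hpos.le] at this
    have hy2 := pyth hy
    -- unfold `sliceSq` at a positive height
    have hs : sliceSq c t = max 0 (min 1 (t ^ 2 / c ^ 2) - t ^ 2) := by
      unfold sliceSq; rw [if_pos ht]
    rw [hs] at hd2 hpos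
    have hmax : max 0 (min 1 (t ^ 2 / c ^ 2) - t ^ 2) = min 1 (t ^ 2 / c ^ 2) - t ^ 2 :=
      max_eq_right (le_of_lt (by
        rcases lt_max_iff.1 hpos with h | h
        · exact absurd h (lt_irrefl 0)
        · exact h))
    rw [hmax] at hd2
    have hn2 : ‖y‖ ^ 2 < min 1 (t ^ 2 / c ^ 2) := by linarith
    refine ⟨⟨?_, ?_⟩, hy⟩
    · rw [hy]
      have h2 : ‖y‖ ^ 2 < t ^ 2 / c ^ 2 := lt_of_lt_of_le hn2 (min_le_right _ _)
      rw [lt_div_iff₀ (by positivity : (0 : ℝ) < c ^ 2)] at h2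
      have h3 : (c * ‖y‖) ^ 2 < t ^ 2 := by nlinarith
      exact lt_of_pow_lt_pow_left₀ 2 ht.le h3
    · have h2 : ‖y‖ ^ 2 < 1 := lt_of_lt_of_le hn2 (min_le_left _ _)
      nlinarith [norm_nonneg y]

/-- **Slicing the cone**: its volume is the integral over heights of the disc areas
`π · sliceSq c t`. [folklore] -/
theorem volume_capCone_eq_lintegral {a : EuclideanSpace ℝ (Fin 3)} (ha : ‖a‖ = 1) {c : ℝ}
    (hc : 0 < c) :
    volume (capCone a c) = ∫⁻ t : ℝ, ENNReal.ofReal (π * sliceSq c t) := by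
  have ha0 : a ≠ 0 := by
    intro h0; rw [h0, norm_zero] at ha; exact zero_ne_one ha
  have hfin : finrank ℝ (EuclideanSpace ℝ (Fin 3)) = 3 := by simp
  have hslice := EuclideanGeometry.euclideanHausdorffMeasure_eq_lintegral
    (V := EuclideanSpace ℝ (Fin 3)) (P := EuclideanSpace ℝ (Fin 3))
    (0 : EuclideanSpace ℝ (Fin 3)) ha0 (measurableSet_capCone a c)
  rw [hfin, EuclideanSpace.euclideanHausdorffMeasure_eq_volume] at hslice
  rw [hslice]
  have hnorm : ‖a‖ₑ = 1 := by
    rw [enorm_eq_nnnorm]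
    have : ‖a‖₊ = 1 := by ext; rw [coe_nnnorm, ha]; rfl
    rw [this]; rfl
  rw [hnorm, one_mul]
  refine lintegral_congr fun t => ?_
  have hset : capCone a c ∩ (AffineSubspace.mk' (t • a +ᵥ (0 : EuclideanSpace ℝ (Fin 3))) (ℝ ∙ a)ᗮ :
      Set (EuclideanSpace ℝ (Fin 3))) =
        {y | ⟪a, y⟫ = t} ∩ ball (t • a) (Real.sqrt (sliceSq c t)) := by
    rw [vadd_eq_add, add_zero]
    exact capCone_inter_plane ha hc t
  rw [show (3 : ℕ) - 1 = 2 from rfl, hset, euclideanHausdorffMeasure_two_disc ha,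
    ← ENNReal.ofReal_pow (Real.sqrt_nonneg _), Real.sq_sqrt (sliceSq_nonneg c t),
    ← ENNReal.ofReal_mul (sliceSq_nonneg c t), mul_comm]

end Cone

/-! ### Part 3. The height integral `∫ sliceSq = 2(1 − c)/3` and the volume of the cone -/

section Integral

/-- `sliceSq c` is measurable. [folklore] -/
theorem measurable_sliceSq (c : ℝ) : Measurable (sliceSq c) := by
  unfold sliceSq
  refine Measurable.ite measurableSet_Ioi ?_ measurable_const
  exact measurable_const.max ((measurable_const.min ((measurable_id.pow_const 2).div_const _)).sub
    (measurable_id.pow_const 2))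

/-- `t ↦ π · sliceSq c t` is integrable (bounded by `π`, supported in `(0, 1]`). [folklore] -/
theorem integrable_pi_mul_sliceSq {c : ℝ} (hc : 0 < c) (hc1 : c ≤ 1) :
    Integrable fun t : ℝ => π * sliceSq c t := by
  have hg : Integrable ((Ioc (0 : ℝ) 1).indicator fun _ => (π : ℝ)) :=
    (integrableOn_const measure_Ioc_lt_top.ne).integrable_indicator measurableSet_Ioc
  refine hg.mono' ((measurable_sliceSq c).const_mul π).aestronglyMeasurable
    (ae_of_all _ fun t => ?_)
  rw [Real.norm_eq_abs, abs_of_nonneg (mul_nonneg pi_pos.le (sliceSq_nonneg c t))]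
  by_cases ht : t ∈ Ioc (0 : ℝ) 1
  · rw [indicator_of_mem ht]
    have := sliceSq_le_one hc hc1 t
    nlinarith [pi_pos]
  · rw [indicator_of_notMem ht]
    rw [mem_Ioc, not_and_or, not_lt, not_le] at ht
    rcases ht with h | h
    · rw [sliceSq_of_nonpos h, mul_zero]
    · rw [sliceSq_of_one_le hc hc1 h.le, mul_zero]

/-- **The height integral**: `∫ π · sliceSq c = 2π(1 − c)/3` for `0 < c ≤ 1`. [folklore] -/
theorem integral_pi_mul_sliceSq {c : ℝ} (hc : 0 < c) (hc1 : c ≤ 1) :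
    ∫ t : ℝ, π * sliceSq c t = 2 * π / 3 * (1 - c) := by
  -- restrict to `(0, 1]`
  have hzero : ∀ t, t ∉ Ioc (0 : ℝ) 1 → π * sliceSq c t = 0 := by
    intro t ht
    rw [mem_Ioc, not_and_or, not_lt, not_le] at ht
    rcases ht with h | h
    · rw [sliceSq_of_nonpos h, mul_zero]
    · rw [sliceSq_of_one_le hc hc1 h.le, mul_zero]
  rw [← setIntegral_eq_integral_of_forall_compl_eq_zero hzero, ← intervalIntegral.integral_of_le
    zero_le_one]
  -- split at `c`
  have hii : ∀ a b : ℝ, IntervalIntegrable (fun t => π * sliceSq c t) volume a b := fun a b =>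
    (integrable_pi_mul_sliceSq hc hc1).intervalIntegrable
  rw [← intervalIntegral.integral_add_adjacent_intervals (hii 0 c) (hii c 1)]
  -- the two pieces
  have h1 : ∫ t in (0 : ℝ)..c, π * sliceSq c t =
      ∫ t in (0 : ℝ)..c, π * ((1 - c ^ 2) / c ^ 2) * t ^ 2 := by
    refine intervalIntegral.integral_congr fun t ht => ?_
    rw [uIcc_of_le hc.le, mem_Icc] at ht
    rcases eq_or_lt_of_le ht.1 with h0 | h0
    · show π * sliceSq c t = π * ((1 - c ^ 2) / c ^ 2) * t ^ 2
      rw [← h0, sliceSq_of_nonpos le_rfl]; ring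
    · show π * sliceSq c t = π * ((1 - c ^ 2) / c ^ 2) * t ^ 2
      rw [sliceSq_of_le hc hc1 h0 ht.2]; ring
  have h2 : ∫ t in c..(1 : ℝ), π * sliceSq c t = ∫ t in c..(1 : ℝ), (π - π * t ^ 2) := by
    refine intervalIntegral.integral_congr fun t ht => ?_
    rw [uIcc_of_le hc1, mem_Icc] at ht
    show π * sliceSq c t = π - π * t ^ 2
    rw [sliceSq_of_ge hc ht.1 ht.2]; ring
  have hA : IntervalIntegrable (fun _ : ℝ => (π : ℝ)) volume c 1 :=
    (continuous_const).intervalIntegrable _ _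
  have hB : IntervalIntegrable (fun t : ℝ => π * t ^ 2) volume c 1 :=
    (by fun_prop : Continuous fun t : ℝ => π * t ^ 2).intervalIntegrable _ _
  rw [h1, h2, intervalIntegral.integral_const_mul, integral_pow,
    intervalIntegral.integral_sub hA hB,
    intervalIntegral.integral_const, intervalIntegral.integral_const_mul, integral_pow]
  simp only [smul_eq_mul]
  norm_num
  field_simp
  ring

/-- **Archimedes: the volume of the cone of half-angle `arccos c` cut off by the unit ball is
`(2π/3)(1 − c)`** (`0 < c ≤ 1`, `a` a unit vector); equivalently the spherical cap of angular
radius `r` has solid angle `2π(1 − cos r)`. [folklore] -/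
theorem volume_capCone {a : EuclideanSpace ℝ (Fin 3)} (ha : ‖a‖ = 1) {c : ℝ} (hc : 0 < c)
    (hc1 : c ≤ 1) : volume (capCone a c) = ENNReal.ofReal (2 * π / 3 * (1 - c)) := by
  rw [volume_capCone_eq_lintegral ha hc, ← integral_pi_mul_sliceSq hc hc1,
    ofReal_integral_eq_lintegral_ofReal (integrable_pi_mul_sliceSq hc hc1)
      (ae_of_all _ fun t => mul_nonneg pi_pos.le (sliceSq_nonneg c t))]

/-- **The unit-ball fraction of the cone** (`= (1 − c)/2`, the normalised solid angle of the cap):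
`vol (capCone a c) / vol B(0,1) = (1 − c)/2`. [folklore] -/
theorem volume_capCone_div {a : EuclideanSpace ℝ (Fin 3)} (ha : ‖a‖ = 1) {c : ℝ} (hc : 0 < c)
    (hc1 : c ≤ 1) :
    (volume (capCone a c)).toReal / (volume (ball (0 : EuclideanSpace ℝ (Fin 3)) 1)).toReal =
      (1 - c) / 2 := by
  rw [volume_capCone ha hc hc1, EuclideanSpace.volume_ball_fin_three, ENNReal.toReal_ofReal
    (by nlinarith [pi_pos]), ENNReal.toReal_mul, ← ENNReal.ofReal_pow zero_le_one,
    ENNReal.toReal_ofReal (by norm_num), ENNReal.toReal_ofReal (by positivity)]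
  field_simp
  ring

end Integral

end Literature.Geometry.DiscreteGeometry

end
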